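import Literature.AlgebraicGeometry.HodgeTheory.MumfordTateRankUnitaryPairBlocks
import HarnessLib

/-!
# Counting `dim 𝔥(H₁ ⊕ H₂)` from two derived corners and the central plane `ℚ·ι₁φ₁π₁ ⊕ ℚ·ι₂φ₂π₂`

COR-CM (cell `pub-hodgecm2`, seat `b27` gen 52, count-neutral Mumford–Tate-rank ladder; theorems only, no definition, no named fact; UNCONDITIONAL —
nothing here uses or asserts HC_CM).  SETTING as in `CorCM/MumfordTateRankUnitaryPairBlocks` (`H = H₁ ⊕ H₂` with bicone `ι_i, π_i`; Hodge
endomorphisms `φ_i ∈ End_Hdg(H_i)`, `φ_i² = −d_i`, `d_i > 0`; `𝔡_i = [𝔥(H_i), 𝔥(H_i)]`, `E_i = ι_iφ_iπ_i`).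
* **`finrank_add_finrank_add_two_le_of_corners`** — if both derived corners `ι_i𝔡_iπ_i` (`CorCM/MumfordTateRankUnitaryPairSplitting`) and both
  `E_i` (`CorCM/MumfordTateRankUnitaryPairCentre`) lie in `𝔥(H)`, then `dim 𝔥(H) ≥ dim 𝔡₁ + dim 𝔡₂ + 2`: the corners are independent (apply
  `Z ↦ π₁Zι₁`), `E₁ ∉ ι₁𝔡₁π₁ ⊕ ι₂𝔡₂π₂` and `E₂ ∉ ι₁𝔡₁π₁ ⊕ ι₂𝔡₂π₂ ⊕ ℚE₁`, since a block `φ_i ∈ 𝔡_i` would have `tr(φ_i²) = 0`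
  (`trace_mul_eq_zero_of_mem_derived_of_mem_endAlg`: derived elements are `φ_i`-trace-free) against `tr(φ_i²) = −d_i dim V_i ≠ 0`.
AV reading (`CorCM/MumfordTateRankTypeIVThreefoldPairsExact`): `t(T × T′) = 8 + 8 + 2 + 1 = 19` for two simple type-IV(2,1) threefolds with different fields.

## References
* [MoonenZarhin1999LowDim] B. Moonen, Yu. G. Zarhin, *Hodge classes on abelian varieties of low dimension*, Math. Ann. 315 (1999), §3 (3.1), Lemma (3.4),
  Prop. (3.8) [corpus: paper:arxiv-math_9901113 pp. 6–7]. [cite: MoonenZarhin1999LowDim, §3 (3.1) and Prop. (3.8)]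
* [Humphreys1972] J. E. Humphreys, GTM 9, §5.1 (trace forms). [cite: Humphreys1972, §5.1]
* [Deligne1982HodgeCycles] P. Deligne, *Hodge cycles on abelian varieties*, LNM 900 (1982), I §3 Prop. 3.6. [cite: Deligne1982HodgeCycles, I §3 Prop. 3.6]

Provenance: Literature home (namespace `Literature.AlgebraicGeometry.HodgeTheory.MumfordTateRank`) of the Summits-side `CorCM/MumfordTateRankUnitaryPairCount` (cell `pub-hodgecm2`, COR-CM; all its imports are `Literature/`, Mathlib and the already re-homed `MumfordTateRankUnitaryPairBlocks`), which `Literature/` may not import; theorems only, no named fact, no definition. Nothing here bears on `HC_CM`. Lane `lit-hodgefound` (Layer A3: CM types, their Kubota ranks and Galois combinatorics), seat p20.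
-/

noncomputable section

open scoped TensorProduct

namespace Literature.AlgebraicGeometry.HodgeTheory.MumfordTateRank

namespace UnitaryPair

open Literature.AlgebraicGeometry.Motives Literature.AlgebraicGeometry.Motives.HodgeStructure Module

universe u

variable {V₁ : Type u} [AddCommGroup V₁] [Module ℚ V₁] [Module.Finite ℚ V₁]
  {V₂ : Type u} [AddCommGroup V₂] [Module ℚ V₂] [Module.Finite ℚ V₂]
  {V : Type u} [AddCommGroup V] [Module ℚ V] [Module.Finite ℚ V] [HodgeTensorFacts.{u, u}] {n : ℤ}
  {H₁ : HodgeStructure V₁ n} {H₂ : HodgeStructure V₂ n} {H : HodgeStructure V n}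
  (ι₁ : Hom H₁ H) (π₁ : Hom H H₁) (ι₂ : Hom H₂ H) (π₂ : Hom H H₂)
  (hπι₁ : ∀ v, π₁.toLinearMap (ι₁.toLinearMap v) = v) (hπι₂ : ∀ v, π₂.toLinearMap (ι₂.toLinearMap v) = v)
  (hsum : ∀ v, ι₁.toLinearMap (π₁.toLinearMap v) + ι₂.toLinearMap (π₂.toLinearMap v) = v)
  {φ₁ : Module.End ℚ V₁} (hφ₁E : φ₁ ∈ H₁.endAlg) {φ₂ : Module.End ℚ V₂} (hφ₂E : φ₂ ∈ H₂.endAlg)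

variable {d₁ : ℚ} (hd₁ : 0 < d₁) (hφ₁2 : φ₁ * φ₁ = -(d₁ • 1)) {d₂ : ℚ} (hd₂ : 0 < d₂) (hφ₂2 : φ₂ * φ₂ = -(d₂ • 1))
  [Nontrivial V₁] [Nontrivial V₂]
  (h𝔠₁ : (Submodule.span ℚ {B | ∃ X ∈ H₁.hodgeLie, ∃ Y ∈ H₁.hodgeLie, X * Y - Y * X = B}).map
        ((LinearMap.llcomp ℚ V V₁ V ι₁.toLinearMap).comp (LinearMap.lcomp ℚ V₁ π₁.toLinearMap)) ≤ H.hodgeLie)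
  (h𝔠₂ : (Submodule.span ℚ {B | ∃ X ∈ H₂.hodgeLie, ∃ Y ∈ H₂.hodgeLie, X * Y - Y * X = B}).map
        ((LinearMap.llcomp ℚ V V₂ V ι₂.toLinearMap).comp (LinearMap.lcomp ℚ V₂ π₂.toLinearMap)) ≤ H.hodgeLie)
  (hE₁ : ι₁.toLinearMap ∘ₗ φ₁ ∘ₗ π₁.toLinearMap ∈ H.hodgeLie) (hE₂ : ι₂.toLinearMap ∘ₗ φ₂ ∘ₗ π₂.toLinearMap ∈ H.hodgeLie)

include hπι₁ hπι₂ hsum hφ₁E hφ₂E hd₁ hφ₁2 hd₂ hφ₂2 h𝔠₁ h𝔠₂ hE₁ hE₂ in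
/-- **`dim 𝔥(H) ≥ dim[𝔥₁,𝔥₁] + dim[𝔥₂,𝔥₂] + 2`** when both derived corners and both `E_i` lie in `𝔥(H)`: the corners `ι₁𝔡₁π₁`, `ι₂𝔡₂π₂` are
independent (apply `Z ↦ π₁Zι₁`), and `E₁ ∉ ι₁𝔡₁π₁ ⊕ ι₂𝔡₂π₂`, `E₂ ∉ ι₁𝔡₁π₁ ⊕ ι₂𝔡₂π₂ ⊕ ℚE₁` since a block `φ_i ∈ 𝔡_i` would give
`tr(φ_i²) = 0` (`trace_mul_eq_zero_of_mem_derived_of_mem_endAlg`) against `tr(φ_i²) = −d_i dim V_i ≠ 0`.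
[cite: MoonenZarhin1999LowDim, §3 (3.1) and Prop. (3.8)] [cite: Humphreys1972, §5.1] -/
theorem finrank_add_finrank_add_two_le_of_corners :
    Module.finrank ℚ ↥(Submodule.span ℚ {B | ∃ X ∈ H₁.hodgeLie, ∃ Y ∈ H₁.hodgeLie, X * Y - Y * X = B}) +
        Module.finrank ℚ ↥(Submodule.span ℚ {B | ∃ X ∈ H₂.hodgeLie, ∃ Y ∈ H₂.hodgeLie, X * Y - Y * X = B}) + 2 ≤
      Module.finrank ℚ H.hodgeLie := by
  classical
  set 𝔥 := H.hodgeLie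
  set 𝔡₁ : Submodule ℚ (Module.End ℚ V₁) := Submodule.span ℚ {B | ∃ X ∈ H₁.hodgeLie, ∃ Y ∈ H₁.hodgeLie, X * Y - Y * X = B} with h𝔡₁def
  set 𝔡₂ : Submodule ℚ (Module.End ℚ V₂) := Submodule.span ℚ {B | ∃ X ∈ H₂.hodgeLie, ∃ Y ∈ H₂.hodgeLie, X * Y - Y * X = B} with h𝔡₂def
  set c₁ : Module.End ℚ V₁ →ₗ[ℚ] Module.End ℚ V := (LinearMap.llcomp ℚ V V₁ V ι₁.toLinearMap).comp (LinearMap.lcomp ℚ V₁ π₁.toLinearMap) with hc₁def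
  set c₂ : Module.End ℚ V₂ →ₗ[ℚ] Module.End ℚ V := (LinearMap.llcomp ℚ V V₂ V ι₂.toLinearMap).comp (LinearMap.lcomp ℚ V₂ π₂.toLinearMap) with hc₂def
  have hc₁ : ∀ Y, c₁ Y = ι₁.toLinearMap ∘ₗ Y ∘ₗ π₁.toLinearMap := fun Y => rfl
  have hc₂ : ∀ Y, c₂ Y = ι₂.toLinearMap ∘ₗ Y ∘ₗ π₂.toLinearMap := fun Y => rfl
  let r₁ : Module.End ℚ V →ₗ[ℚ] Module.End ℚ V₁ := (LinearMap.llcomp ℚ V₁ V V₁ π₁.toLinearMap).comp (LinearMap.lcomp ℚ V ι₁.toLinearMap)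
  let r₂ : Module.End ℚ V →ₗ[ℚ] Module.End ℚ V₂ := (LinearMap.llcomp ℚ V₂ V V₂ π₂.toLinearMap).comp (LinearMap.lcomp ℚ V ι₂.toLinearMap)
  have hr₁ : ∀ X, r₁ X = π₁.toLinearMap ∘ₗ X ∘ₗ ι₁.toLinearMap := fun X => rfl
  have hr₂ : ∀ X, r₂ X = π₂.toLinearMap ∘ₗ X ∘ₗ ι₂.toLinearMap := fun X => rfl
  have h12 : ∀ w, π₁.toLinearMap (ι₂.toLinearMap w) = 0 := fun w => by
    simpa only [LinearMap.comp_apply, LinearMap.zero_apply] using congrArg (fun f => f w) (proj₁_comp_incl₂ ι₁ π₁ ι₂ π₂ hπι₁ hπι₂ hsum)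
  have h21 : ∀ w, π₂.toLinearMap (ι₁.toLinearMap w) = 0 := fun w => by
    simpa only [LinearMap.comp_apply, LinearMap.zero_apply] using congrArg (fun f => f w) (proj₂_comp_incl₁ ι₁ π₁ ι₂ π₂ hπι₁ hπι₂ hsum)
  have hr₁c₁ : ∀ Y, r₁ (c₁ Y) = Y := fun Y => by rw [hr₁, hc₁]; refine LinearMap.ext fun v => ?_; simp only [LinearMap.comp_apply, hπι₁]
  have hr₂c₂ : ∀ Y, r₂ (c₂ Y) = Y := fun Y => by rw [hr₂, hc₂]; refine LinearMap.ext fun v => ?_; simp only [LinearMap.comp_apply, hπι₂]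
  have hr₁c₂ : ∀ Y, r₁ (c₂ Y) = 0 := fun Y => by
    rw [hr₁, hc₂]; refine LinearMap.ext fun v => ?_; simp only [LinearMap.comp_apply, h12, LinearMap.zero_apply]
  have hr₂c₁ : ∀ Y, r₂ (c₁ Y) = 0 := fun Y => by
    rw [hr₂, hc₁]; refine LinearMap.ext fun v => ?_; simp only [LinearMap.comp_apply, h21, LinearMap.zero_apply]
  have hE₁' : ι₁.toLinearMap ∘ₗ φ₁ ∘ₗ π₁.toLinearMap = c₁ φ₁ := (hc₁ φ₁).symm
  have hE₂' : ι₂.toLinearMap ∘ₗ φ₂ ∘ₗ π₂.toLinearMap = c₂ φ₂ := (hc₂ φ₂).symm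
  -- `φ_i ∉ 𝔡_i` by the trace
  have hφ𝔡₁ : φ₁ ∉ 𝔡₁ := fun h => by
    have htr := trace_mul_eq_zero_of_mem_derived_of_mem_endAlg (H₁ := H₁) hφ₁E h
    rw [hφ₁2, map_neg, map_smul, LinearMap.trace_one, smul_eq_mul, neg_eq_zero, mul_eq_zero] at htr
    rcases htr with h' | h'
    · exact hd₁.ne' h'
    · exact Module.finrank_pos.ne' (by exact_mod_cast h')
  have hφ𝔡₂ : φ₂ ∉ 𝔡₂ := fun h => by
    have htr := trace_mul_eq_zero_of_mem_derived_of_mem_endAlg (H₁ := H₂) hφ₂E h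
    rw [hφ₂2, map_neg, map_smul, LinearMap.trace_one, smul_eq_mul, neg_eq_zero, mul_eq_zero] at htr
    rcases htr with h' | h'
    · exact hd₂.ne' h'
    · exact Module.finrank_pos.ne' (by exact_mod_cast h')
  -- the corners are independent
  have hinj₁ : Function.Injective c₁ := fun a b h => by have h' := congrArg r₁ h; rwa [hr₁c₁, hr₁c₁] at h'
  have hinj₂ : Function.Injective c₂ := fun a b h => by have h' := congrArg r₂ h; rwa [hr₂c₂, hr₂c₂] at h'
  have hdisj : 𝔡₁.map c₁ ⊓ 𝔡₂.map c₂ = ⊥ := by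
    refine (Submodule.eq_bot_iff _).2 fun X hX => ?_
    obtain ⟨hX₁, hX₂⟩ := Submodule.mem_inf.1 hX
    obtain ⟨Y₁, -, rfl⟩ := hX₁
    obtain ⟨Y₂, -, hY⟩ := hX₂
    have h := congrArg r₁ hY
    rw [hr₁c₂, hr₁c₁] at h
    rw [← h, map_zero]
  have hdimD : Module.finrank ℚ ↥(𝔡₁.map c₁ ⊔ 𝔡₂.map c₂) = Module.finrank ℚ 𝔡₁ + Module.finrank ℚ 𝔡₂ := by
    have h := Submodule.finrank_sup_add_finrank_inf_eq (𝔡₁.map c₁) (𝔡₂.map c₂)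
    rw [hdisj, finrank_bot, add_zero, ← LinearEquiv.finrank_eq (Submodule.equivMapOfInjective c₁ hinj₁ 𝔡₁),
      ← LinearEquiv.finrank_eq (Submodule.equivMapOfInjective c₂ hinj₂ 𝔡₂)] at h
    exact h
  -- `E₁ ∉ D`, `E₂ ∉ D ⊔ ℚE₁`
  set D := 𝔡₁.map c₁ ⊔ 𝔡₂.map c₂ with hDdef
  have hE₁D : c₁ φ₁ ∉ D := fun hmem => by
    obtain ⟨A, hA, B, hB, hAB⟩ := Submodule.mem_sup.1 hmem
    obtain ⟨Y₁, hY₁, rfl⟩ := hA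
    obtain ⟨Y₂, -, rfl⟩ := hB
    have h := congrArg r₁ hAB
    rw [map_add, hr₁c₁, hr₁c₂, add_zero, hr₁c₁] at h
    exact hφ𝔡₁ (h ▸ hY₁)
  have hE₂D : c₂ φ₂ ∉ D ⊔ (ℚ ∙ c₁ φ₁) := fun hmem => by
    obtain ⟨A, hA, B, hB, hAB⟩ := Submodule.mem_sup.1 hmem
    obtain ⟨A₁, hA₁, A₂, hA₂, rfl⟩ := Submodule.mem_sup.1 hA
    obtain ⟨Y₁, -, rfl⟩ := hA₁
    obtain ⟨Y₂, hY₂, rfl⟩ := hA₂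
    obtain ⟨c, rfl⟩ := Submodule.mem_span_singleton.1 hB
    have h := congrArg r₂ hAB
    rw [map_add, map_add, map_smul, hr₂c₁, hr₂c₂, hr₂c₁, zero_add, smul_zero, add_zero, hr₂c₂] at h
    exact hφ𝔡₂ (h ▸ hY₂)
  have hD𝔥 : D ≤ 𝔥 := sup_le h𝔠₁ h𝔠₂
  have hlt₁ : D < D ⊔ (ℚ ∙ c₁ φ₁) :=
    lt_of_le_of_ne le_sup_left fun heq => hE₁D (heq ▸ Submodule.mem_sup_right (Submodule.mem_span_singleton_self _))
  have hlt₂ : D ⊔ (ℚ ∙ c₁ φ₁) < D ⊔ (ℚ ∙ c₁ φ₁) ⊔ (ℚ ∙ c₂ φ₂) :=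
    lt_of_le_of_ne le_sup_left fun heq => hE₂D (heq ▸ Submodule.mem_sup_right (Submodule.mem_span_singleton_self _))
  have hle : D ⊔ (ℚ ∙ c₁ φ₁) ⊔ (ℚ ∙ c₂ φ₂) ≤ 𝔥 :=
    sup_le (sup_le hD𝔥 ((Submodule.span_singleton_le_iff_mem _ _).2 (hE₁' ▸ hE₁))) ((Submodule.span_singleton_le_iff_mem _ _).2 (hE₂' ▸ hE₂))
  have h1 := Submodule.finrank_lt_finrank_of_lt hlt₁
  have h2 := Submodule.finrank_lt_finrank_of_lt hlt₂
  have h3 := Submodule.finrank_mono hle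
  rw [hdimD] at h1
  omega

end UnitaryPair

end Literature.AlgebraicGeometry.HodgeTheory.MumfordTateRank

end
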